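/-
Copyright (c) 2026 the pub-hodgecm-mathlib formalisation cell (harness21).  Prover seat hodgecm-mathlib-B-p04 (g48); LH4-plan (g7) WORD #10 DEAL (h′) ∕ WORD #14 (d) (the shape),
head file; 2026-09-02.  Sequel of ★ `UnramifiedQuadraticNormFormCountCore` (p851934, this seat).
-/
import Literature.NumberTheory.LocalFields.UnramifiedQuadraticNormFormCountCore
import HarnessLib

/-!
# The NORM-FORM pair count of the trace frame: pairs (unit or norm class `ν̄`) × (trace-fibre class `w̄`) with `N(w)·ν² + β(w)·ν + p ≡ 0 (mod 𝔪^k)`, 2-free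

Topic `NumberTheory/LocalFields`, namespace `Literature.NumberTheory.LocalFields.UnramifiedQuadraticNorm`.  THEOREMS ONLY: no definition, no named fact, no instance, no notation,
no `sorry`; kernel lane `--supports stmt-HodgeConjecture-24833`.  Cell `pub/hodgecm-mathlib` (D-0151), crux H413; LH4-plan (g7) WORD #10 deal (h′) = the LocalFields GATE (I4) of
F0P3a-p09's CENSUS-C3 `BorelCountsTrace` (9b5d3560); SHAPE = LH4-plan WORD #14 (d) ∕ F0P3a-p09's (C3a) (N) + `condition_four_iff_quadratic_normForm`: in the TRACE frame, regime 4 of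
Flicker's Prop. 10 reads `|B₂|·|N(w)·ν² + β·ν + p| ≤ |t|²` with `ν = uσu` a NORM (= any σ-fixed unit class), `w = x + z` on the TRACE FIBRE `{w : w + σw = z + σz}` (`x` anti-fixed;
`z + σz = −yσy` a unit), `β = β₁w + β₂σw` (`β₁ = (A − b)∕B₂`, `β₂ = (D − b)∕B₂ = σβ₁`), `|N(w)| = 1`, `|p| < 1` — NOT the symmetric-frame quadratic `ν²(1 − x²) + dν + p` of ★
`natCard_pairs_norm_quadratic_eq (h2)`.  THIS FILE counts the residue pairs of that congruence in BOTH first-coordinate currencies, as instances of the core (★ p851934):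
`a(w) = N(w)` is a unit on the whole fibre in EVERY residue characteristic as soon as the fibre's trace `z + σz` is (★ core `isUnit_mul_map_of_isUnit_add_map` — FINDING #14), `β(w)` is
`σ̄`-fixed as soon as `σβ₁ ≡ β₂`, its unit-ness is the consumer's regime hypothesis, `p` is nilpotent (`|p| < 1`) and `σ`-fixed.  VALUES: over `(u, w̄)` (unit classes mod `𝔪^m`):
`q^m · q^{m−k} · q^{m−1}(q+1)` (★ :262's VERBATIM); over `(ν̄, w̄)` (σ-fixed unit classes = norm classes): `q^m · q^{m−k}` (the norm fibre `q^{m−1}(q+1)` divided out; ★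
`natCard_fixed_fibre_factor`).  `1 ≤ k ≤ m` as in ★; the (C3d) consumer fixes `k = 2m − ν`.
HONEST LABEL: HC_CM is proved only modulo the 7 printed citations (2 remaining named inputs: hLiu418 = stmt-HodgeConjecture-24832, h413 = stmt-HodgeConjecture-24833) until rung 0
closes; finite commutative algebra, count-neutral ((D-UNR) PRINT by D74′; pays no organ, opens no road).

* §1 `natCard_traceFibre_quotient_pow` (`#{w̄ : w + σ̄w = z + σ̄z} = q^m`), `natCard_fixed_quadratic_eq_of_isUnit` (per-`w` count over σ-FIXED unit classes `= q^{m−k}`);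
* §2 **`natCard_pairs_norm_form_eq`** (currency `(u, w̄)`), **`natCard_pairs_norm_form_eq_fixedUnits`** (currency `(ν̄, w̄)`).

## References
* [Flicker1998UnitaryFL] Y. Z. Flicker, *Elementary proof of the fundamental lemma for a unitary group*, Canad. J. Math. 50 (1998), 74–98: Prop. 10 p. 86.
* [Serre1979] J.-P. Serre, *Local Fields*, GTM 67 (1979), Ch. V §2 Prop. 3 and Corollary.
-/

set_option autoImplicit false

namespace Literature.NumberTheory.LocalFields.UnramifiedQuadraticNorm

open Literature.LinearAlgebra.Matrix.HermitianFormsHensel Literature.NumberTheory.GaloisRepresentations IsLocalRing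

universe u

section Count

variable {R : Type u} [CommRing R] (σ : R →+* R)
variable [IsDomain R] [IsDiscreteValuationRing R] [Finite (ResidueField R)] [IsAdicComplete (maximalIdeal R) R]
  (hσ : ∀ a, σ (σ a) = a) {a : R} (ha : IsUnit (σ a - a)) {q : ℕ} (hq : Nat.card (ResidueField R) = q ^ 2)

/-! ## §1 The trace fibre and the per-`w` count over norm classes -/

omit [Finite (ResidueField R)] [IsAdicComplete (maximalIdeal R) R] in
include hσ ha hq in
/-- **`#{w ∈ R ⧸ 𝔪^m : w + σ̄w = z + σ̄z} = q^m`** for any class `z`: `w ↦ w − z` is a bijection onto the anti-fixed classes (★ `natCard_antifixed_quotient_pow`) — the trace fibre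
`w = x + z` of the (C3a) normal form. [cite: Serre1979, Ch. V §2 Prop. 2–3] [cite: Flicker1998UnitaryFL, Prop. 10 p. 86] -/
theorem natCard_traceFibre_quotient_pow (m : ℕ) (z : R ⧸ maximalIdeal R ^ m) :
    Nat.card {w : R ⧸ maximalIdeal R ^ m // w + Ideal.quotientMap (maximalIdeal R ^ m) σ (maximalIdeal_pow_le_comap σ hσ m) w =
      z + Ideal.quotientMap (maximalIdeal R ^ m) σ (maximalIdeal_pow_le_comap σ hσ m) z} = q ^ m := by
  set σm := Ideal.quotientMap (maximalIdeal R ^ m) σ (maximalIdeal_pow_le_comap σ hσ m) with hσm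
  rw [← natCard_antifixed_quotient_pow σ hσ ha hq m]
  refine Nat.card_congr
    { toFun := fun w => ⟨w.1 - z, ?_⟩
      invFun := fun x => ⟨x.1 + z, ?_⟩
      left_inv := fun w => Subtype.ext (by simp)
      right_inv := fun x => Subtype.ext (by simp) }
  · have h := w.2
    rw [map_sub]
    linear_combination h
  · have h := x.2
    rw [map_add, h]
    ring

omit [IsAdicComplete (maximalIdeal R) R] in
include hσ ha hq in
/-- **Per-coefficient count over NORM CLASSES** (σ-fixed unit classes mod `𝔪^m`): for `1 ≤ k ≤ m` and classes `a₀ d₀ p₀` whose reductions mod `𝔪^k` are `σ̄_k`-fixed with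
`a₀, d₀` units and `p₀` nilpotent, `#{ν ∈ R ⧸ 𝔪^m : σ̄ν = ν, ν ∈ (R ⧸ 𝔪^m)ˣ, a₀ν² + d₀ν + p₀ ≡ 0 (mod 𝔪^k)} = q^{m−k}` — the σ-fixed classes above the unique unit root
(★ `natCard_fixed_fibre_factor`). [cite: Flicker1998UnitaryFL, Prop. 10 p. 86] -/
theorem natCard_fixed_quadratic_eq_of_isUnit {k m : ℕ} (hk : 1 ≤ k) (hkm : k ≤ m) (a₀ d₀ p₀ : R ⧸ maximalIdeal R ^ m)
    (ha₀ : IsUnit (Ideal.Quotient.factor (Ideal.pow_le_pow_right hkm) a₀))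
    (hσa₀ : Ideal.quotientMap (maximalIdeal R ^ k) σ (maximalIdeal_pow_le_comap σ hσ k) (Ideal.Quotient.factor (Ideal.pow_le_pow_right hkm) a₀) =
      Ideal.Quotient.factor (Ideal.pow_le_pow_right hkm) a₀)
    (hd₀ : IsUnit (Ideal.Quotient.factor (Ideal.pow_le_pow_right hkm) d₀))
    (hσd₀ : Ideal.quotientMap (maximalIdeal R ^ k) σ (maximalIdeal_pow_le_comap σ hσ k) (Ideal.Quotient.factor (Ideal.pow_le_pow_right hkm) d₀) =
      Ideal.Quotient.factor (Ideal.pow_le_pow_right hkm) d₀)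
    (hp₀ : IsNilpotent (Ideal.Quotient.factor (Ideal.pow_le_pow_right hkm) p₀))
    (hσp₀ : Ideal.quotientMap (maximalIdeal R ^ k) σ (maximalIdeal_pow_le_comap σ hσ k) (Ideal.Quotient.factor (Ideal.pow_le_pow_right hkm) p₀) =
      Ideal.Quotient.factor (Ideal.pow_le_pow_right hkm) p₀) :
    Nat.card {ν : R ⧸ maximalIdeal R ^ m // Ideal.quotientMap (maximalIdeal R ^ m) σ (maximalIdeal_pow_le_comap σ hσ m) ν = ν ∧ (IsUnit ν ∧
      Ideal.Quotient.factor (Ideal.pow_le_pow_right hkm) (a₀ * ν ^ 2 + d₀ * ν + p₀) = 0)} = q ^ (m - k) := by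
  set σm := Ideal.quotientMap (maximalIdeal R ^ m) σ (maximalIdeal_pow_le_comap σ hσ m) with hσm
  set σk := Ideal.quotientMap (maximalIdeal R ^ k) σ (maximalIdeal_pow_le_comap σ hσ k) with hσk
  set φ := Ideal.Quotient.factor (S := maximalIdeal R ^ m) (T := maximalIdeal R ^ k) (Ideal.pow_le_pow_right hkm) with hφ
  haveI : Nontrivial (R ⧸ maximalIdeal R ^ k) := nontrivial_quotient_pow (R := R) hk
  haveI : IsLocalRing (R ⧸ maximalIdeal R ^ k) :=
    IsLocalRing.of_surjective' (Ideal.Quotient.mk (maximalIdeal R ^ k)) Ideal.Quotient.mk_surjective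
  -- the unique, σ-fixed unit root `c`
  obtain ⟨c, hcu, hcE⟩ := exists_unit_quadratic_root_of_isUnit hp₀ ha₀ hd₀
  have hσc : σk c = c := quadratic_root_fixed_of_isUnit σk hp₀ ha₀ hcu hσa₀ hσd₀ hσp₀ hcE
  rw [← natCard_fixed_fibre_factor σ hσ ha hq hkm c hσc]
  refine Nat.card_congr (Equiv.subtypeEquivRight fun ν => ?_)
  have hE : φ (a₀ * ν ^ 2 + d₀ * ν + p₀) = φ a₀ * (φ ν) ^ 2 + φ d₀ * φ ν + φ p₀ := by
    simp only [map_add, map_mul, map_pow]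
  show σm ν = ν ∧ (IsUnit ν ∧ φ _ = 0) ↔ σm ν = ν ∧ φ ν = c
  refine and_congr_right fun _ => ⟨fun ⟨hνu, hzero⟩ => ?_, fun hνc => ⟨?_, ?_⟩⟩
  · rw [hE] at hzero
    exact quadratic_root_unique_of_isUnit hp₀ ha₀ (hνu.map φ) hcu hzero hcE
  · -- `ν` is a unit since `φ ν = c` is
    obtain ⟨ν₀, rfl⟩ := Ideal.Quotient.mk_surjective ν
    have hνk : IsUnit (Ideal.Quotient.mk (maximalIdeal R ^ k) ν₀) := by
      have : φ (Ideal.Quotient.mk (maximalIdeal R ^ m) ν₀) = Ideal.Quotient.mk (maximalIdeal R ^ k) ν₀ := by rw [hφ, Ideal.Quotient.factor_mk]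
      rw [← this, hνc]; exact hcu
    exact (isUnit_of_isUnit_mk_pow hk hνk).map _
  · rw [hE, hνc]; exact hcE

/-! ## §2 The norm-form pair counts on the trace fibre -/

include hσ ha hq in
/-- **THE NORM-FORM PAIR COUNT, currency `(u, w̄)`** — LH4-plan (g7) WORD #14 (d): for `1 ≤ k ≤ m`, a fibre base `z` with `z + σ̄z` a unit mod `𝔪^k`, slopes `β₁ β₂` with
`σ̄β₁ ≡ β₂ (mod 𝔪^k)`, `p₀` nilpotent and `σ̄`-fixed mod `𝔪^k`, and `β(w) = β₁w + β₂σ̄w` a unit mod `𝔪^k` along the fibre: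
`#{(u, w) ∈ (R ⧸ 𝔪^m)ˣ × (R ⧸ 𝔪^m) : w + σ̄w = z + σ̄z, N(w)·N(u)² + β(w)·N(u) + p₀ ≡ 0 (mod 𝔪^k)} = q^m · q^{m−k} · q^{m−1}(q+1)` (`N(y) = y·σ̄y`) — ★ :262's value
VERBATIM, every residue characteristic. [cite: Flicker1998UnitaryFL, Prop. 10 p. 86] -/
theorem natCard_pairs_norm_form_eq {k m : ℕ} (hk : 1 ≤ k) (hkm : k ≤ m) (z β₁ β₂ p₀ : R ⧸ maximalIdeal R ^ m)
    (hz : IsUnit (Ideal.Quotient.factor (Ideal.pow_le_pow_right hkm) (z + Ideal.quotientMap (maximalIdeal R ^ m) σ (maximalIdeal_pow_le_comap σ hσ m) z)))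
    (hβ : Ideal.quotientMap (maximalIdeal R ^ k) σ (maximalIdeal_pow_le_comap σ hσ k) (Ideal.Quotient.factor (Ideal.pow_le_pow_right hkm) β₁) =
      Ideal.Quotient.factor (Ideal.pow_le_pow_right hkm) β₂)
    (hp₀ : IsNilpotent (Ideal.Quotient.factor (Ideal.pow_le_pow_right hkm) p₀))
    (hσp₀ : Ideal.quotientMap (maximalIdeal R ^ k) σ (maximalIdeal_pow_le_comap σ hσ k) (Ideal.Quotient.factor (Ideal.pow_le_pow_right hkm) p₀) =
      Ideal.Quotient.factor (Ideal.pow_le_pow_right hkm) p₀)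
    (hβu : ∀ w : R ⧸ maximalIdeal R ^ m,
      w + Ideal.quotientMap (maximalIdeal R ^ m) σ (maximalIdeal_pow_le_comap σ hσ m) w = z + Ideal.quotientMap (maximalIdeal R ^ m) σ (maximalIdeal_pow_le_comap σ hσ m) z →
      IsUnit (Ideal.Quotient.factor (Ideal.pow_le_pow_right hkm) (β₁ * w + β₂ * Ideal.quotientMap (maximalIdeal R ^ m) σ (maximalIdeal_pow_le_comap σ hσ m) w))) :
    Nat.card {uw : (R ⧸ maximalIdeal R ^ m) × (R ⧸ maximalIdeal R ^ m) //
      uw.2 + Ideal.quotientMap (maximalIdeal R ^ m) σ (maximalIdeal_pow_le_comap σ hσ m) uw.2 =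
        z + Ideal.quotientMap (maximalIdeal R ^ m) σ (maximalIdeal_pow_le_comap σ hσ m) z ∧ (IsUnit uw.1 ∧
      Ideal.Quotient.factor (Ideal.pow_le_pow_right hkm)
        (uw.2 * Ideal.quotientMap (maximalIdeal R ^ m) σ (maximalIdeal_pow_le_comap σ hσ m) uw.2 *
            (uw.1 * Ideal.quotientMap (maximalIdeal R ^ m) σ (maximalIdeal_pow_le_comap σ hσ m) uw.1) ^ 2 +
          (β₁ * uw.2 + β₂ * Ideal.quotientMap (maximalIdeal R ^ m) σ (maximalIdeal_pow_le_comap σ hσ m) uw.2) *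
            (uw.1 * Ideal.quotientMap (maximalIdeal R ^ m) σ (maximalIdeal_pow_le_comap σ hσ m) uw.1) + p₀) = 0)} =
      q ^ m * (q ^ (m - k) * (q ^ (m - 1) * (q + 1))) := by
  classical
  haveI := CompleteLocalRing.finite_quotient_maximalIdeal_pow (R := R) m
  set σm := Ideal.quotientMap (maximalIdeal R ^ m) σ (maximalIdeal_pow_le_comap σ hσ m) with hσm
  set σk := Ideal.quotientMap (maximalIdeal R ^ k) σ (maximalIdeal_pow_le_comap σ hσ k) with hσk
  set φ := Ideal.Quotient.factor (S := maximalIdeal R ^ m) (T := maximalIdeal R ^ k) (Ideal.pow_le_pow_right hkm) with hφ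
  haveI : Nontrivial (R ⧸ maximalIdeal R ^ k) := nontrivial_quotient_pow (R := R) hk
  haveI : IsLocalRing (R ⧸ maximalIdeal R ^ k) :=
    IsLocalRing.of_surjective' (Ideal.Quotient.mk (maximalIdeal R ^ k)) Ideal.Quotient.mk_surjective
  have hσmσm : ∀ y, σm (σm y) = y := quotientMap_quotientMap σ hσ m
  have hσkσk : ∀ y, σk (σk y) = y := quotientMap_quotientMap σ hσ k
  have hφσ : ∀ y, φ (σm y) = σk (φ y) := fun y => factor_quotientMap σ hσ hkm y
  -- the coefficient clauses of the core, along the fibre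
  have had : ∀ w : R ⧸ maximalIdeal R ^ m, w + σm w = z + σm z →
      IsUnit (φ (w * σm w)) ∧ σk (φ (w * σm w)) = φ (w * σm w) ∧ IsUnit (φ (β₁ * w + β₂ * σm w)) ∧
      σk (φ (β₁ * w + β₂ * σm w)) = φ (β₁ * w + β₂ * σm w) ∧ IsNilpotent (φ p₀) ∧ σk (φ p₀) = φ p₀ := by
    intro w hw
    have hβ' : σk (φ β₂) = φ β₁ := by rw [← hβ, hσkσk]
    refine ⟨?_, ?_, hβu w hw, ?_, hp₀, hσp₀⟩
    · rw [map_mul, hφσ]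
      refine isUnit_mul_map_of_isUnit_add_map σk hσkσk ?_
      rw [← hφσ, ← map_add, hw]; exact hz
    · rw [← hφσ, map_mul, hσmσm, mul_comm]
    · rw [map_add, map_mul, map_mul, map_add, map_mul, map_mul, hβ, hβ', hφσ, hσkσk]; ring
  let P : R ⧸ maximalIdeal R ^ m → Prop := fun w => w + σm w = z + σm z
  let Q : (R ⧸ maximalIdeal R ^ m) → (R ⧸ maximalIdeal R ^ m) → Prop := fun w u => IsUnit u ∧
    φ (w * σm w * (u * σm u) ^ 2 + (β₁ * w + β₂ * σm w) * (u * σm u) + p₀) = 0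
  let X := {w : R ⧸ maximalIdeal R ^ m // P w}
  haveI : Finite X := Subtype.finite
  letI : Fintype X := Fintype.ofFinite X
  have e : {uw : (R ⧸ maximalIdeal R ^ m) × (R ⧸ maximalIdeal R ^ m) // P uw.2 ∧ Q uw.2 uw.1} ≃ Σ w : X, {u : R ⧸ maximalIdeal R ^ m // Q w.1 u} :=
    { toFun := fun uw => ⟨⟨uw.1.2, uw.2.1⟩, ⟨uw.1.1, uw.2.2⟩⟩
      invFun := fun y => ⟨(y.2.1, y.1.1), y.1.2, y.2.2⟩
      left_inv := fun uw => rfl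
      right_inv := fun y => rfl }
  rw [Nat.card_congr e, Nat.card_sigma]
  have hfib : ∀ w : X, Nat.card {u : R ⧸ maximalIdeal R ^ m // Q w.1 u} = q ^ (m - k) * (q ^ (m - 1) * (q + 1)) := fun w => by
    obtain ⟨h1, h2, h3, h4, h5, h6⟩ := had w.1 w.2
    exact natCard_norm_quadratic_eq_of_isUnit σ hσ ha hq hk hkm (w.1 * σm w.1) (β₁ * w.1 + β₂ * σm w.1) p₀ h1 h2 h3 h4 h5 h6
  rw [Finset.sum_congr rfl fun w _ => hfib w, Finset.sum_const, smul_eq_mul, Finset.card_univ, ← Nat.card_eq_fintype_card]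
  congr 1
  exact natCard_traceFibre_quotient_pow σ hσ ha hq m z

omit [IsAdicComplete (maximalIdeal R) R] in
include hσ ha hq in
/-- **THE NORM-FORM PAIR COUNT, currency `(ν̄, w̄)`** (`ν̄` a σ-FIXED unit class = a norm class, by ★ `UnramifiedLocalConjDatum`-type norm surjectivity): same hypotheses,
`#{(ν, w) ∈ (R ⧸ 𝔪^m)² : w + σ̄w = z + σ̄z, σ̄ν = ν, ν a unit, N(w)·ν² + β(w)·ν + p₀ ≡ 0 (mod 𝔪^k)} = q^m · q^{m−k}` (the norm fibre `q^{m−1}(q+1)` of `u ↦ uσ̄u` divided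
out of `natCard_pairs_norm_form_eq`). [cite: Flicker1998UnitaryFL, Prop. 10 p. 86] -/
theorem natCard_pairs_norm_form_eq_fixedUnits {k m : ℕ} (hk : 1 ≤ k) (hkm : k ≤ m) (z β₁ β₂ p₀ : R ⧸ maximalIdeal R ^ m)
    (hz : IsUnit (Ideal.Quotient.factor (Ideal.pow_le_pow_right hkm) (z + Ideal.quotientMap (maximalIdeal R ^ m) σ (maximalIdeal_pow_le_comap σ hσ m) z)))
    (hβ : Ideal.quotientMap (maximalIdeal R ^ k) σ (maximalIdeal_pow_le_comap σ hσ k) (Ideal.Quotient.factor (Ideal.pow_le_pow_right hkm) β₁) =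
      Ideal.Quotient.factor (Ideal.pow_le_pow_right hkm) β₂)
    (hp₀ : IsNilpotent (Ideal.Quotient.factor (Ideal.pow_le_pow_right hkm) p₀))
    (hσp₀ : Ideal.quotientMap (maximalIdeal R ^ k) σ (maximalIdeal_pow_le_comap σ hσ k) (Ideal.Quotient.factor (Ideal.pow_le_pow_right hkm) p₀) =
      Ideal.Quotient.factor (Ideal.pow_le_pow_right hkm) p₀)
    (hβu : ∀ w : R ⧸ maximalIdeal R ^ m,
      w + Ideal.quotientMap (maximalIdeal R ^ m) σ (maximalIdeal_pow_le_comap σ hσ m) w = z + Ideal.quotientMap (maximalIdeal R ^ m) σ (maximalIdeal_pow_le_comap σ hσ m) z →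
      IsUnit (Ideal.Quotient.factor (Ideal.pow_le_pow_right hkm) (β₁ * w + β₂ * Ideal.quotientMap (maximalIdeal R ^ m) σ (maximalIdeal_pow_le_comap σ hσ m) w))) :
    Nat.card {νw : (R ⧸ maximalIdeal R ^ m) × (R ⧸ maximalIdeal R ^ m) //
      νw.2 + Ideal.quotientMap (maximalIdeal R ^ m) σ (maximalIdeal_pow_le_comap σ hσ m) νw.2 =
        z + Ideal.quotientMap (maximalIdeal R ^ m) σ (maximalIdeal_pow_le_comap σ hσ m) z ∧
      (Ideal.quotientMap (maximalIdeal R ^ m) σ (maximalIdeal_pow_le_comap σ hσ m) νw.1 = νw.1 ∧ (IsUnit νw.1 ∧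
      Ideal.Quotient.factor (Ideal.pow_le_pow_right hkm)
        (νw.2 * Ideal.quotientMap (maximalIdeal R ^ m) σ (maximalIdeal_pow_le_comap σ hσ m) νw.2 * νw.1 ^ 2 +
          (β₁ * νw.2 + β₂ * Ideal.quotientMap (maximalIdeal R ^ m) σ (maximalIdeal_pow_le_comap σ hσ m) νw.2) * νw.1 + p₀) = 0))} =
      q ^ m * q ^ (m - k) := by
  classical
  haveI := CompleteLocalRing.finite_quotient_maximalIdeal_pow (R := R) m
  set σm := Ideal.quotientMap (maximalIdeal R ^ m) σ (maximalIdeal_pow_le_comap σ hσ m) with hσm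
  set σk := Ideal.quotientMap (maximalIdeal R ^ k) σ (maximalIdeal_pow_le_comap σ hσ k) with hσk
  set φ := Ideal.Quotient.factor (S := maximalIdeal R ^ m) (T := maximalIdeal R ^ k) (Ideal.pow_le_pow_right hkm) with hφ
  haveI : Nontrivial (R ⧸ maximalIdeal R ^ k) := nontrivial_quotient_pow (R := R) hk
  haveI : IsLocalRing (R ⧸ maximalIdeal R ^ k) :=
    IsLocalRing.of_surjective' (Ideal.Quotient.mk (maximalIdeal R ^ k)) Ideal.Quotient.mk_surjective
  have hσmσm : ∀ y, σm (σm y) = y := quotientMap_quotientMap σ hσ m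
  have hσkσk : ∀ y, σk (σk y) = y := quotientMap_quotientMap σ hσ k
  have hφσ : ∀ y, φ (σm y) = σk (φ y) := fun y => factor_quotientMap σ hσ hkm y
  have had : ∀ w : R ⧸ maximalIdeal R ^ m, w + σm w = z + σm z →
      IsUnit (φ (w * σm w)) ∧ σk (φ (w * σm w)) = φ (w * σm w) ∧ IsUnit (φ (β₁ * w + β₂ * σm w)) ∧
      σk (φ (β₁ * w + β₂ * σm w)) = φ (β₁ * w + β₂ * σm w) ∧ IsNilpotent (φ p₀) ∧ σk (φ p₀) = φ p₀ := by
    intro w hw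
    have hβ' : σk (φ β₂) = φ β₁ := by rw [← hβ, hσkσk]
    refine ⟨?_, ?_, hβu w hw, ?_, hp₀, hσp₀⟩
    · rw [map_mul, hφσ]
      refine isUnit_mul_map_of_isUnit_add_map σk hσkσk ?_
      rw [← hφσ, ← map_add, hw]; exact hz
    · rw [← hφσ, map_mul, hσmσm, mul_comm]
    · rw [map_add, map_mul, map_mul, map_add, map_mul, map_mul, hβ, hβ', hφσ, hσkσk]; ring
  let P : R ⧸ maximalIdeal R ^ m → Prop := fun w => w + σm w = z + σm z
  let Q : (R ⧸ maximalIdeal R ^ m) → (R ⧸ maximalIdeal R ^ m) → Prop := fun w ν => σm ν = ν ∧ (IsUnit ν ∧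
    φ (w * σm w * ν ^ 2 + (β₁ * w + β₂ * σm w) * ν + p₀) = 0)
  let X := {w : R ⧸ maximalIdeal R ^ m // P w}
  haveI : Finite X := Subtype.finite
  letI : Fintype X := Fintype.ofFinite X
  have e : {νw : (R ⧸ maximalIdeal R ^ m) × (R ⧸ maximalIdeal R ^ m) // P νw.2 ∧ Q νw.2 νw.1} ≃ Σ w : X, {ν : R ⧸ maximalIdeal R ^ m // Q w.1 ν} :=
    { toFun := fun νw => ⟨⟨νw.1.2, νw.2.1⟩, ⟨νw.1.1, νw.2.2⟩⟩
      invFun := fun y => ⟨(y.2.1, y.1.1), y.1.2, y.2.2⟩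
      left_inv := fun νw => rfl
      right_inv := fun y => rfl }
  rw [Nat.card_congr e, Nat.card_sigma]
  have hfib : ∀ w : X, Nat.card {ν : R ⧸ maximalIdeal R ^ m // Q w.1 ν} = q ^ (m - k) := fun w => by
    obtain ⟨h1, h2, h3, h4, h5, h6⟩ := had w.1 w.2
    exact natCard_fixed_quadratic_eq_of_isUnit σ hσ ha hq hk hkm (w.1 * σm w.1) (β₁ * w.1 + β₂ * σm w.1) p₀ h1 h2 h3 h4 h5 h6
  rw [Finset.sum_congr rfl fun w _ => hfib w, Finset.sum_const, smul_eq_mul, Finset.card_univ, ← Nat.card_eq_fintype_card]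
  congr 1
  exact natCard_traceFibre_quotient_pow σ hσ ha hq m z

end Count

end Literature.NumberTheory.LocalFields.UnramifiedQuadraticNorm
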